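import Summits.CriticalPhenomena.SAWScalingLimit.Theses.SAWCompassLattice
import Literature.Barriers.CriticalPhenomena.NienhuisWeightsExcludeVertexSAW

/-!
# `CompassRealisation` (item stmt-CriticalPhenomena-6963): the compass gadget realises the
# Nienhuis weights at `θ = π/2`

Stub `stub_compassRealisation` of line `Sketch` for the crux `HexTransfer`
(stmt-CriticalPhenomena-14221); lands `--supports stmt-CriticalPhenomena-14221`.

**Statement** (`SAWCompassLattice.CompassRealisation`, verbatim): there are reals `α, β, s, z > 0`
with `z² T_adj = u₁(π/2)`, `z² T_opp = v(π/2)`, `z⁴ D = w₁(π/2)`, where `T_adj, T_opp, D` are the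
route polynomials of the compass gadget (`tAdj`, `tOpp`, `dPair` below, written in `S = s²`) and
`u₁, v, w₁` the Nienhuis / Glazman–Manolescu weights `weightU1`, `weightV`, `weightW1`.

**Proof.** (1) With `c = cos(π/16)`, `σ = sin(π/16)` the closed forms of
`NienhuisWeightsExcludeVertexSAW` read `u₁ = (c - σ)/(2c²)`, `v = (c - σ)²/(2c²)`,
`w₁ = √2 (c - σ) σ/(2c²)`; Mathlib's radicals `Real.cos_pi_div_sixteen`, `Real.sin_pi_div_sixteen`
give decimal brackets of `c, σ, √2`, hence of `u₁, v, w₁` (`weights_pi_div_two_mem_Ioo`).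
(2) `z := √(u₁/T_adj)` reduces the system to `u₁ T_opp = v T_adj`, `u₁² D = w₁ T_adj²`.
(3) Fix `β = 1/2`; in `S` the first equation is `A(α) S² + B(α) S + C(α) = 0` with `A > 0 > C`
for `0 < α ≤ 3/10` (`quad_eq`, `qA_pos`, `qC_neg`); its positive root `S(α)` (`rootS`) is
continuous. (4) `G(α) := u₁² D(α, S(α)) - w₁ T_adj(α, S(α))²` (`gFun`) is continuous on
`[1/10, 3/10]` with `G(1/10) > 0 > G(3/10)`: the sign of the quadratic brackets
`S(1/10) ∈ [0.866, 0.867]`, `S(3/10) ∈ [0.646, 0.647]`, and monotonicity of `D`, `T_adj` in `S`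
plus step (1) reduce both signs to rational arithmetic (`norm_num`). The intermediate value
theorem yields `α⋆` with `G(α⋆) = 0`; the witness is `(α⋆, 1/2, √S(α⋆), √(u₁/T_adj))`
(numerically `α⋆ ≈ 0.1729`, `S(α⋆) ≈ 0.8077`; one member of a one-parameter family).
-/

noncomputable section

namespace Summit.CriticalPhenomena.SAWScalingLimit.Cruxes.HexTransfer.Sketch.Compass

open Real Set Literature.Probability.RandomPlanarGeometry.SAW.YangBaxter
  Literature.Barriers.CriticalPhenomena

/-! ### Step 1: closed forms and decimal brackets of the weights at `θ = π/2` -/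

/-- `cos(π/16) > 0`. [folklore] -/
theorem cos_pi_div_sixteen_pos : 0 < cos (π / 16) := by
  rw [← sin_pi_div_two_sub, show π / 2 - π / 16 = 7 * π / 16 by ring]
  exact sin_seven_pi_div_sixteen_pos

/-- `u₁(π/2) = (c - σ)/(2c²)`, `v(π/2) = (c - σ)²/(2c²)`, `w₁(π/2) = √2 (c - σ) σ/(2c²)` with
`c = cos(π/16)`, `σ = sin(π/16)` (via `sin(7π/16) = c`, `sin(5π/4) = -√2/2`,
`sin(3π/16) = (√2/2)(c - σ)`). [cite: Glazman2015WeightedSAW, (1.1), (1.3), (1.4)] -/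
theorem weights_pi_div_two_eq_cos_sin :
    weightU1 (π / 2) = (cos (π / 16) - sin (π / 16)) / (2 * cos (π / 16) ^ 2) ∧
    weightV (π / 2) = (cos (π / 16) - sin (π / 16)) ^ 2 / (2 * cos (π / 16) ^ 2) ∧
    weightW1 (π / 2) =
      √2 * (cos (π / 16) - sin (π / 16)) * sin (π / 16) / (2 * cos (π / 16) ^ 2) := by
  have hc := cos_pi_div_sixteen_pos
  have h2 : √2 * √2 = 2 := Real.mul_self_sqrt (by norm_num)
  have h7 : sin (7 * π / 16) = cos (π / 16) := by
    rw [← sin_pi_div_two_sub]; congr 1; ring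
  have h5 : sin (5 * π / 4) = -(√2 / 2) := by
    rw [show 5 * π / 4 = π / 4 + π by ring, sin_add_pi, sin_pi_div_four]
  have h3 : sin (3 * π / 16) = √2 / 2 * cos (π / 16) - √2 / 2 * sin (π / 16) := by
    rw [show 3 * π / 16 = π / 4 - π / 16 by ring, sin_sub, sin_pi_div_four, cos_pi_div_four]
  rw [weightU1_pi_div_two, weightV_pi_div_two, weightW1_pi_div_two, weightDen_pi_div_two, h7,
    h5, h3]
  refine ⟨?_, ?_, ?_⟩
  · field_simp
    linear_combination (cos (π / 16) - sin (π / 16)) * h2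
  · field_simp
    linear_combination (cos (π / 16) - sin (π / 16)) ^ 2 * h2
  · field_simp

/-- `1.41421356 < √2 < 1.41421357`. [folklore] -/
theorem sqrt_two_mem_Ioo : (1.41421356 : ℝ) < √2 ∧ √2 < 1.41421357 := by
  constructor
  · rw [Real.lt_sqrt (by norm_num)]; norm_num
  · rw [Real.sqrt_lt' (by norm_num)]; norm_num

/-- `0.98078526 < cos(π/16) = √(2 + √(2 + √2))/2 < 0.98078531` (three squarings). [folklore] -/
theorem cos_pi_div_sixteen_mem_Ioo :
    (0.98078526 : ℝ) < cos (π / 16) ∧ cos (π / 16) < 0.98078531 := by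
  rw [Real.cos_pi_div_sixteen]
  constructor
  · rw [lt_div_iff₀ two_pos, Real.lt_sqrt (by norm_num), ← sub_lt_iff_lt_add',
      Real.lt_sqrt (by norm_num), ← sub_lt_iff_lt_add', Real.lt_sqrt (by norm_num)]
    norm_num
  · rw [div_lt_iff₀ two_pos, Real.sqrt_lt' (by norm_num), ← lt_sub_iff_add_lt',
      Real.sqrt_lt' (by norm_num), ← lt_sub_iff_add_lt', Real.sqrt_lt' (by norm_num)]
    norm_num

/-- `0.19509028 < sin(π/16) = √(2 - √(2 + √2))/2 < 0.19509037` (three squarings). [folklore] -/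
theorem sin_pi_div_sixteen_mem_Ioo :
    (0.19509028 : ℝ) < sin (π / 16) ∧ sin (π / 16) < 0.19509037 := by
  rw [Real.sin_pi_div_sixteen]
  constructor
  · rw [lt_div_iff₀ two_pos, Real.lt_sqrt (by norm_num), lt_sub_comm,
      Real.sqrt_lt' (by norm_num), ← lt_sub_iff_add_lt', Real.sqrt_lt' (by norm_num)]
    norm_num
  · rw [div_lt_iff₀ two_pos, Real.sqrt_lt' (by norm_num), sub_lt_comm,
      Real.lt_sqrt (by norm_num), ← sub_lt_iff_lt_add', Real.lt_sqrt (by norm_num)]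
    norm_num

/-- `u₁(π/2) ∈ (0.408388, 0.408393)`, `v(π/2) ∈ (0.320868, 0.320873)`,
`w₁(π/2) ∈ (0.112672, 0.112677)` (true values `0.4083909…`, `0.3208707…`, `0.1126748…`;
"`1/u₁(π/2) = 2.448…`, `v/u₁ ≈ 0.785`, `w₁/u₁² ≈ 0.675`"). [cite: Glazman2015WeightedSAW, p. 3] -/
theorem weights_pi_div_two_mem_Ioo :
    ((0.408388 : ℝ) < weightU1 (π / 2) ∧ weightU1 (π / 2) < 0.408393) ∧
    ((0.320868 : ℝ) < weightV (π / 2) ∧ weightV (π / 2) < 0.320873) ∧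
    ((0.112672 : ℝ) < weightW1 (π / 2) ∧ weightW1 (π / 2) < 0.112677) := by
  obtain ⟨hc1, hc2⟩ := cos_pi_div_sixteen_mem_Ioo
  obtain ⟨hs1, hs2⟩ := sin_pi_div_sixteen_mem_Ioo
  obtain ⟨hq1, hq2⟩ := sqrt_two_mem_Ioo
  obtain ⟨hu, hv, hw⟩ := weights_pi_div_two_eq_cos_sin
  have hc := cos_pi_div_sixteen_pos
  have h2c : (0 : ℝ) < 2 * cos (π / 16) ^ 2 := by positivity
  have hcc1 : (0.98078526 : ℝ) ^ 2 < cos (π / 16) ^ 2 := by nlinarith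
  have hcc2 : cos (π / 16) ^ 2 < (0.98078531 : ℝ) ^ 2 := by nlinarith
  have hd1 : (0.98078526 - 0.19509037 : ℝ) ^ 2 < (cos (π / 16) - sin (π / 16)) ^ 2 := by
    nlinarith
  have hd2 : (cos (π / 16) - sin (π / 16)) ^ 2 < (0.98078531 - 0.19509028 : ℝ) ^ 2 := by
    nlinarith
  -- two-sided bounds of the product of the three positive factors `√2`, `c - σ`, `σ`
  have hp1 : (1.41421356 : ℝ) * (0.98078526 - 0.19509037) * 0.19509028 ≤
      √2 * (cos (π / 16) - sin (π / 16)) * sin (π / 16) :=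
    mul_le_mul (mul_le_mul hq1.le (by linarith) (by norm_num) (Real.sqrt_nonneg _)) hs1.le
      (by norm_num) (mul_nonneg (Real.sqrt_nonneg _) (by linarith))
  have hp2 : √2 * (cos (π / 16) - sin (π / 16)) * sin (π / 16) ≤
      1.41421357 * (0.98078531 - 0.19509028) * 0.19509037 :=
    mul_le_mul (mul_le_mul hq2.le (by linarith) (by linarith) (by norm_num)) hs2.le
      (by linarith) (by norm_num)
  rw [hu, hv, hw]
  refine ⟨⟨?_, ?_⟩, ⟨?_, ?_⟩, ⟨?_, ?_⟩⟩
  · rw [lt_div_iff₀ h2c]; linarith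
  · rw [div_lt_iff₀ h2c]; linarith
  · rw [lt_div_iff₀ h2c]; linarith
  · rw [div_lt_iff₀ h2c]; linarith
  · rw [lt_div_iff₀ h2c]; linarith
  · rw [div_lt_iff₀ h2c]; linarith

/-! ### Step 2: the compass polynomials and the quadratic in `S = s²` at `β = 1/2` -/

/-- `T_adj(α, β, S)`: generating polynomial (in `S = s²`) of the 22 simple routes between two
ADJACENT terminals of the compass gadget (first polynomial of `CompassRealisation`). [folklore] -/
def tAdj (α β S : ℝ) : ℝ :=
  α ^ 2 + α ^ 6 + S * (2 * α ^ 2 * β + 2 * α ^ 2 * β ^ 2 + 2 * α ^ 2 * β ^ 3 + 2 * α ^ 4 * β +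
    4 * α ^ 4 * β ^ 2 + 2 * α ^ 4 * β ^ 3 + 2 * α ^ 6 * β + 2 * α ^ 6 * β ^ 3) +
    2 * S ^ 2 * α ^ 4 * β ^ 2

/-- `T_opp(α, β, S)`: generating polynomial (in `S = s²`) of the 24 simple routes between two
OPPOSITE terminals of the compass gadget (second polynomial of `CompassRealisation`). [folklore] -/
def tOpp (α β S : ℝ) : ℝ :=
  2 * α ^ 4 + S * (2 * α ^ 2 * β + 4 * α ^ 2 * β ^ 2 + 2 * α ^ 2 * β ^ 3 + 4 * α ^ 4 * β +
    4 * α ^ 4 * β ^ 3 + 4 * α ^ 6 * β ^ 2) + 2 * S ^ 2 * α ^ 4 * β ^ 2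

/-- `D(α, β, S)`: generating polynomial (in `S = s²`) of the 15 vertex-disjoint pairs of adjacent
routes of the compass gadget (third polynomial of `CompassRealisation`). [folklore] -/
def dPair (α β S : ℝ) : ℝ :=
  α ^ 4 + S * (4 * α ^ 4 * β + 4 * α ^ 4 * β ^ 2 + 4 * α ^ 4 * β ^ 3) + 2 * S ^ 2 * α ^ 4 * β ^ 2

/-- `T_adj ≥ 0` for `β, S ≥ 0`. [folklore] -/
theorem tAdj_nonneg (α : ℝ) {β S : ℝ} (hβ : 0 ≤ β) (hS : 0 ≤ S) : 0 ≤ tAdj α β S := by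
  unfold tAdj; positivity

/-- `T_adj` is monotone in `S ≥ 0`. [folklore] -/
theorem tAdj_mono (α : ℝ) {β S₁ S₂ : ℝ} (hβ : 0 ≤ β) (h₁ : 0 ≤ S₁) (h : S₁ ≤ S₂) :
    tAdj α β S₁ ≤ tAdj α β S₂ := by
  have hk : 0 ≤ 2 * α ^ 2 * β + 2 * α ^ 2 * β ^ 2 + 2 * α ^ 2 * β ^ 3 + 2 * α ^ 4 * β +
      4 * α ^ 4 * β ^ 2 + 2 * α ^ 4 * β ^ 3 + 2 * α ^ 6 * β + 2 * α ^ 6 * β ^ 3 := by positivity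
  have hl : 0 ≤ 2 * α ^ 4 * β ^ 2 := by positivity
  unfold tAdj
  nlinarith [mul_le_mul_of_nonneg_right h hk,
    mul_le_mul_of_nonneg_right (pow_le_pow_left₀ h₁ h 2) hl]

/-- `D` is monotone in `S ≥ 0`. [folklore] -/
theorem dPair_mono (α : ℝ) {β S₁ S₂ : ℝ} (hβ : 0 ≤ β) (h₁ : 0 ≤ S₁) (h : S₁ ≤ S₂) :
    dPair α β S₁ ≤ dPair α β S₂ := by
  have hk : 0 ≤ 4 * α ^ 4 * β + 4 * α ^ 4 * β ^ 2 + 4 * α ^ 4 * β ^ 3 := by positivity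
  have hl : 0 ≤ 2 * α ^ 4 * β ^ 2 := by positivity
  unfold dPair
  nlinarith [mul_le_mul_of_nonneg_right h hk,
    mul_le_mul_of_nonneg_right (pow_le_pow_left₀ h₁ h 2) hl]

/-- Leading coefficient `A(α) = α⁴ (u₁ - v)/2` of `u₁ T_opp - v T_adj` in `S` (`β = 1/2`).
[folklore] -/
def qA (α : ℝ) : ℝ := α ^ 4 / 2 * (weightU1 (π / 2) - weightV (π / 2))

/-- Middle coefficient `B(α)` of `u₁ T_opp - v T_adj` in `S` (`β = 1/2`). [folklore] -/
def qB (α : ℝ) : ℝ :=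
  weightU1 (π / 2) * (9 / 4 * α ^ 2 + 5 / 2 * α ^ 4 + α ^ 6) -
    weightV (π / 2) * (7 / 4 * α ^ 2 + 9 / 4 * α ^ 4 + 5 / 4 * α ^ 6)

/-- Constant coefficient `C(α) = 2α⁴ u₁ - (α² + α⁶) v` of `u₁ T_opp - v T_adj` in `S`
(`β = 1/2`). [folklore] -/
def qC (α : ℝ) : ℝ := 2 * α ^ 4 * weightU1 (π / 2) - (α ^ 2 + α ^ 6) * weightV (π / 2)

/-- `u₁ T_opp - v T_adj = A S² + B S + C` at `β = 1/2`. [folklore] -/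
theorem quad_eq (α S : ℝ) :
    weightU1 (π / 2) * tOpp α (1 / 2) S - weightV (π / 2) * tAdj α (1 / 2) S =
      qA α * S ^ 2 + qB α * S + qC α := by
  unfold tOpp tAdj qA qB qC; ring

/-- The positive root `S(α) = (-B + √(B² - 4AC)) / (2A)` of the quadratic. [folklore] -/
def rootS (α : ℝ) : ℝ := (-qB α + √(qB α ^ 2 - 4 * qA α * qC α)) / (2 * qA α)

/-- `G(α) = u₁² D(α, ½, S(α)) - w₁ T_adj(α, ½, S(α))²`: the defect of the third equation along
the solution curve of the second. [folklore] -/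
def gFun (α : ℝ) : ℝ :=
  weightU1 (π / 2) ^ 2 * dPair α (1 / 2) (rootS α) -
    weightW1 (π / 2) * tAdj α (1 / 2) (rootS α) ^ 2

/-- `A(α) > 0` for `α ≠ 0` (since `v < u₁`). [folklore] -/
theorem qA_pos {α : ℝ} (hα : α ≠ 0) : 0 < qA α :=
  mul_pos (by positivity) (sub_pos.2 weightV_lt_weightU1_pi_div_two)

/-- `C(α) < 0` for `0 < α ≤ 3/10` (as `2α² u₁ ≤ 0.18 u₁ < v`). [folklore] -/
theorem qC_neg {α : ℝ} (h0 : 0 < α) (h1 : α ≤ 3 / 10) : qC α < 0 := by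
  obtain ⟨⟨-, hu2⟩, ⟨hv1, -⟩, -⟩ := weights_pi_div_two_mem_Ioo
  have hu0 := weightU1_pi_div_two_pos
  have hα2 : α ^ 2 ≤ 9 / 100 := by nlinarith
  have key : 2 * α ^ 2 * weightU1 (π / 2) - (1 + α ^ 4) * weightV (π / 2) < 0 := by
    nlinarith [mul_le_mul_of_nonneg_right hα2 hu0.le,
      mul_nonneg (by positivity : (0 : ℝ) ≤ α ^ 4) (by linarith : (0 : ℝ) ≤ weightV (π / 2))]
  have : qC α = α ^ 2 * (2 * α ^ 2 * weightU1 (π / 2) - (1 + α ^ 4) * weightV (π / 2)) := by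
    unfold qC; ring
  rw [this]
  exact mul_neg_of_pos_of_neg (by positivity) key

/-! ### Step 3: the positive root of a real quadratic with `A > 0 > C` -/

/-- For `A > 0 > C`, `(-B + √(B² - 4AC))/(2A)` is positive and a root. [folklore] -/
theorem quadRoot_pos_and_eq {A B C : ℝ} (hA : 0 < A) (hC : C < 0) :
    0 < (-B + √(B ^ 2 - 4 * A * C)) / (2 * A) ∧
      A * ((-B + √(B ^ 2 - 4 * A * C)) / (2 * A)) ^ 2 +
        B * ((-B + √(B ^ 2 - 4 * A * C)) / (2 * A)) + C = 0 := by
  set r := √(B ^ 2 - 4 * A * C) with hr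
  have hAC : 0 < -(4 * A * C) := by nlinarith [mul_pos hA (neg_pos.2 hC)]
  have hr0 : 0 ≤ r := Real.sqrt_nonneg _
  have hr2 : r ^ 2 = B ^ 2 - 4 * A * C := Real.sq_sqrt (by nlinarith [sq_nonneg B])
  have hBr : B < r := by
    by_contra h
    nlinarith [mul_self_le_mul_self hr0 (not_lt.1 h)]
  refine ⟨div_pos (by linarith) (by linarith), ?_⟩
  have : A * ((-B + r) / (2 * A)) ^ 2 + B * ((-B + r) / (2 * A)) + C =
      (r ^ 2 - (B ^ 2 - 4 * A * C)) / (4 * A) := by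
    field_simp; ring
  rw [this, hr2, sub_self, zero_div]

/-- Lower bracket: `lo ≥ 0` with the quadratic `≤ 0` at `lo` lies below the positive root.
[folklore] -/
theorem le_quadRoot {A B C lo : ℝ} (hA : 0 < A) (hC : C < 0) (hlo : 0 ≤ lo)
    (hQ : A * lo ^ 2 + B * lo + C ≤ 0) : lo ≤ (-B + √(B ^ 2 - 4 * A * C)) / (2 * A) := by
  rw [le_div_iff₀ (by positivity)]
  have h1 : lo * (2 * A) + B ≤ √(B ^ 2 - 4 * A * C) :=
    (le_abs_self _).trans (Real.abs_le_sqrt (by nlinarith [mul_nonpos_iff.2 (Or.inl ⟨hA.le, hQ⟩)]))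
  have := hC; have := hlo
  linarith

/-- Upper bracket: `hi ≥ 0` with the quadratic `≥ 0` at `hi` lies above the positive root.
[folklore] -/
theorem quadRoot_le {A B C hi : ℝ} (hA : 0 < A) (hC : C < 0) (hhi : 0 ≤ hi)
    (hQ : 0 ≤ A * hi ^ 2 + B * hi + C) : (-B + √(B ^ 2 - 4 * A * C)) / (2 * A) ≤ hi := by
  rw [div_le_iff₀ (by positivity)]
  have h1 : 0 < hi * (A * hi + B) := by nlinarith
  have h2 : 0 < A * hi + B := by
    by_contra h
    nlinarith [mul_nonneg hhi (neg_nonneg.2 (not_lt.1 h))]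
  have h3 : 0 < hi * (2 * A) + B := by nlinarith [mul_nonneg hA.le hhi]
  have h4 : √(B ^ 2 - 4 * A * C) ≤ hi * (2 * A) + B := by
    rw [Real.sqrt_le_left h3.le]
    nlinarith [mul_nonneg hA.le hQ]
  linarith

/-! ### Step 4: brackets of `S(α)` and signs of `G` at the endpoints, continuity, IVT -/

/-- Bracketing `S(α)` by the sign of `u₁ T_opp - v T_adj` at `lo, hi ≥ 0`. [folklore] -/
theorem rootS_mem_Icc {α lo hi : ℝ} (h0 : 0 < α) (h1 : α ≤ 3 / 10) (hlo : 0 ≤ lo) (hhi : 0 ≤ hi)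
    (hQlo : weightU1 (π / 2) * tOpp α (1 / 2) lo - weightV (π / 2) * tAdj α (1 / 2) lo ≤ 0)
    (hQhi : 0 ≤ weightU1 (π / 2) * tOpp α (1 / 2) hi - weightV (π / 2) * tAdj α (1 / 2) hi) :
    lo ≤ rootS α ∧ rootS α ≤ hi := by
  rw [quad_eq] at hQlo hQhi
  exact ⟨le_quadRoot (qA_pos h0.ne') (qC_neg h0 h1) hlo hQlo,
    quadRoot_le (qA_pos h0.ne') (qC_neg h0 h1) hhi hQhi⟩

/-- `S(1/10) ∈ [0.866, 0.867]`. [folklore] -/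
theorem rootS_one_div_ten_mem : (0.866 : ℝ) ≤ rootS (1 / 10) ∧ rootS (1 / 10) ≤ 0.867 := by
  obtain ⟨⟨hu1, hu2⟩, ⟨hv1, hv2⟩, -⟩ := weights_pi_div_two_mem_Ioo
  refine rootS_mem_Icc (by norm_num) (by norm_num) (by norm_num) (by norm_num) ?_ ?_ <;>
    norm_num [tOpp, tAdj] <;> linarith

/-- `S(3/10) ∈ [0.646, 0.647]`. [folklore] -/
theorem rootS_three_div_ten_mem : (0.646 : ℝ) ≤ rootS (3 / 10) ∧ rootS (3 / 10) ≤ 0.647 := by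
  obtain ⟨⟨hu1, hu2⟩, ⟨hv1, hv2⟩, -⟩ := weights_pi_div_two_mem_Ioo
  refine rootS_mem_Icc (by norm_num) (by norm_num) (by norm_num) (by norm_num) ?_ ?_ <;>
    norm_num [tOpp, tAdj] <;> linarith

/-- Two-sided bounds of `G(α)` from a bracket `lo ≤ S(α) ≤ hi` (monotonicity of `D`, `T_adj` in
`S` and the decimal brackets of `u₁`, `w₁`). [folklore] -/
theorem gFun_mem_Icc {α lo hi : ℝ} (hlo : 0 ≤ lo) (h : lo ≤ rootS α ∧ rootS α ≤ hi) :
    0.408388 ^ 2 * dPair α (1 / 2) lo - 0.112677 * tAdj α (1 / 2) hi ^ 2 ≤ gFun α ∧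
      gFun α ≤ 0.408393 ^ 2 * dPair α (1 / 2) hi - 0.112672 * tAdj α (1 / 2) lo ^ 2 := by
  obtain ⟨⟨hu1, hu2⟩, -, ⟨hw1, hw2⟩⟩ := weights_pi_div_two_mem_Ioo
  have hu0 := weightU1_pi_div_two_pos
  have hw0 := weightW1_pi_div_two_pos
  have h2 : (0 : ℝ) ≤ 1 / 2 := by norm_num
  have hS0 : 0 ≤ rootS α := hlo.trans h.1
  have hXl := dPair_mono α h2 hlo h.1
  have hXu := dPair_mono α h2 hS0 h.2
  have hYl := pow_le_pow_left₀ (tAdj_nonneg α h2 hlo) (tAdj_mono α h2 hlo h.1) 2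
  have hYu := pow_le_pow_left₀ (tAdj_nonneg α h2 hS0) (tAdj_mono α h2 hS0 h.2) 2
  have hX0 : 0 ≤ dPair α (1 / 2) lo := by unfold dPair; positivity
  have hu2l : (0.408388 : ℝ) ^ 2 ≤ weightU1 (π / 2) ^ 2 :=
    pow_le_pow_left₀ (by norm_num) hu1.le 2
  have hu2u : weightU1 (π / 2) ^ 2 ≤ (0.408393 : ℝ) ^ 2 := pow_le_pow_left₀ hu0.le hu2.le 2
  unfold gFun
  constructor
  · nlinarith [mul_le_mul_of_nonneg_left hXl (sq_nonneg (weightU1 (π / 2))),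
      mul_le_mul_of_nonneg_left hYu hw0.le, mul_le_mul_of_nonneg_right hu2l hX0,
      mul_le_mul_of_nonneg_right hw2.le (sq_nonneg (tAdj α (1 / 2) hi))]
  · nlinarith [mul_le_mul_of_nonneg_left hXu (sq_nonneg (weightU1 (π / 2))),
      mul_le_mul_of_nonneg_left hYl hw0.le,
      mul_le_mul_of_nonneg_right hu2u (hX0.trans hXl |>.trans hXu),
      mul_le_mul_of_nonneg_right hw1.le (sq_nonneg (tAdj α (1 / 2) lo))]

/-- `G(1/10) > 0` (margin `≈ 1 %`). [folklore] -/
theorem gFun_one_div_ten_pos : 0 < gFun (1 / 10) := by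
  refine lt_of_lt_of_le ?_ (gFun_mem_Icc (by norm_num) rootS_one_div_ten_mem).1
  norm_num [dPair, tAdj]

/-- `G(3/10) < 0` (margin `≈ 2.5 %`). [folklore] -/
theorem gFun_three_div_ten_neg : gFun (3 / 10) < 0 := by
  refine lt_of_le_of_lt (gFun_mem_Icc (by norm_num) rootS_three_div_ten_mem).2 ?_
  norm_num [dPair, tAdj]

/-- `S(α)` is continuous on `[1/10, 3/10]` (where `A(α) ≠ 0`). [folklore] -/
theorem continuousOn_rootS : ContinuousOn rootS (Icc (1 / 10) (3 / 10)) := by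
  have hne : ∀ x ∈ Icc (1 / 10 : ℝ) (3 / 10),
      2 * (x ^ 4 / 2 * (weightU1 (π / 2) - weightV (π / 2))) ≠ 0 := fun x hx =>
    mul_ne_zero two_ne_zero (qA_pos (α := x) (by have := hx.1; positivity)).ne'
  unfold rootS qA qB qC
  exact ContinuousOn.div₀ (by fun_prop) (by fun_prop) hne

/-- `G` is continuous on `[1/10, 3/10]`. [folklore] -/
theorem continuousOn_gFun : ContinuousOn gFun (Icc (1 / 10) (3 / 10)) := by
  have h := continuousOn_rootS
  unfold gFun dPair tAdj
  fun_prop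

end Compass

/-! ### The stub -/

open Real Set Literature.Probability.RandomPlanarGeometry.SAW.YangBaxter
  Literature.Barriers.CriticalPhenomena Compass in
/-- **Compass realisation** (item stmt-CriticalPhenomena-6963 = stub `stub_compassRealisation` of
line `Sketch` for crux `HexTransfer`, stmt-CriticalPhenomena-14221): there are `α, β, s, z > 0`
solving the three compass equations against `u₁(π/2), v(π/2), w₁(π/2)`. Witness: `β = 1/2`,
`α = α⋆ ∈ [1/10, 3/10]` a zero of `Compass.gFun` (intermediate value theorem), `s = √S(α⋆)`,
`z = √(u₁/T_adj)`. [folklore] -/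
theorem stub_compassRealisation :
    Summit.CriticalPhenomena.SAWScalingLimit.Theses.SAWCompassLattice.CompassRealisation := by
  -- the zero of `G`
  obtain ⟨a, ha, hga⟩ : ∃ a ∈ Icc (1 / 10 : ℝ) (3 / 10), gFun a = 0 :=
    intermediate_value_Icc' (by norm_num) continuousOn_gFun
      ⟨gFun_three_div_ten_neg.le, gFun_one_div_ten_pos.le⟩
  have ha0 : 0 < a := by have := ha.1; positivity
  obtain ⟨hS0, hSeq⟩ := quadRoot_pos_and_eq (B := qB a) (qA_pos ha0.ne') (qC_neg ha0 ha.2)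
  change 0 < rootS a at hS0
  change qA a * rootS a ^ 2 + qB a * rootS a + qC a = 0 at hSeq
  rw [← quad_eq] at hSeq
  have hu0 := weightU1_pi_div_two_pos
  have hT0 : 0 < tAdj a (1 / 2) (rootS a) := by unfold tAdj; positivity
  have hs2 : √(rootS a) ^ 2 = rootS a := Real.sq_sqrt hS0.le
  have hs4 : √(rootS a) ^ 4 = rootS a ^ 2 := by
    rw [show (4 : ℕ) = 2 * 2 from rfl, pow_mul, hs2]
  have hz2 : √(weightU1 (π / 2) / tAdj a (1 / 2) (rootS a)) ^ 2 =
      weightU1 (π / 2) / tAdj a (1 / 2) (rootS a) := Real.sq_sqrt (div_pos hu0 hT0).le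
  have hz4 : √(weightU1 (π / 2) / tAdj a (1 / 2) (rootS a)) ^ 4 =
      (weightU1 (π / 2) / tAdj a (1 / 2) (rootS a)) ^ 2 := by
    rw [show (4 : ℕ) = 2 * 2 from rfl, pow_mul, hz2]
  refine ⟨a, 1 / 2, √(rootS a), √(weightU1 (π / 2) / tAdj a (1 / 2) (rootS a)), ha0, by norm_num,
    Real.sqrt_pos.2 hS0, Real.sqrt_pos.2 (div_pos hu0 hT0), ?_, ?_, ?_⟩
  · rw [hz2, div_mul_eq_mul_div, div_eq_iff hT0.ne', hs2, hs4]
    unfold tAdj; ring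
  · rw [hz2, div_mul_eq_mul_div, div_eq_iff hT0.ne', hs2, hs4]
    unfold tAdj tOpp at hSeq; unfold tAdj; linear_combination hSeq
  · rw [hz4, div_pow, div_mul_eq_mul_div, div_eq_iff (pow_ne_zero 2 hT0.ne'), hs2, hs4]
    unfold gFun dPair tAdj at hga; unfold tAdj; linear_combination hga

end Summit.CriticalPhenomena.SAWScalingLimit.Cruxes.HexTransfer.Sketch

end
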